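import Summits.Ventures.HodgeRepro.KubotaLit2
import Summits.Ventures.HodgeRepro.LitRankChar
import Summits.Ventures.HodgeRepro.SingleClass
import Summits.Ventures.HodgeRepro.CyclicTwoPowerNondegenerate

/-!
# Abelian Galois groups: a single-class `SumTwo` quadruple without a conjugate pair needs a DEGENERATE type

Blind re-derivation cell `pub-hodge-repro`, seat `p1` (gen 6).  Built on typer-2's Kubota character
formula (`KubotaChar.lean` / `KubotaLit2.lean`) and lit-2's character count (`LitRankChar.lean`), with
Mathlib's orthogonality of characters (`AddChar.sum_apply_eq_ite`).

**Theorem** (`exists_conj_of_sumTwo_of_isNondegenerate`): let `G` be a finite ABELIAN group with complex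
conjugation `c`, `Φ` a NON-DEGENERATE CM type (`cmRank Φ = |Φ| + 1`), and `T = (Φ g₀, Φ g₁, Φ g₂, Φ g₃)` a
`SumTwo` quadruple of twists of `Φ`.  Then two corners are complex conjugate: `T j = c • T i`.
Equivalently (`not_isSingleClass_of_isNondegenerate`, the shape of typer's `QuadFinset12.lean` rows):
a single-class `SumTwo` quadruple of CM types without a conjugate pair forces its type to be
DEGENERATE.  This is the combinatorial shadow, in the cell's vocabulary, of Hazama's theorem
([Gordon] Thm 6.4 / §9.3, `route/SOURCES.md`): exceptional Hodge classes on `A_Φ` need a degenerate type.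

Proof.  (A) Non-degeneracy means, by the character formula, that EVERY odd character `χ` (`χ(c) = -1`)
has `∑_{s ∈ Φ} χ(s) ≠ 0` (`charSum_ne_zero_of_isNondegenerate`: the odd characters with non-zero sum
are `|Φ|` in number, and there are only `|G|/2 = |Φ|` odd characters).  (B) `SumTwo` says
`∑_i 1_{Φ g_i} = 2 · 1_G`; applying `χ` gives `(∑_i χ(g_i)) · ∑_Φ χ = 2 ∑_G χ = 0`, so
`∑_i χ(g_i) = 0` for every odd `χ` (`sum_char_twists_eq_zero`).  (C) The function
`F(x) = #{i : g_i = x} − #{i : g_i = c x}` then has every character sum zero (for even `χ` trivially),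
hence `F = 0` by Fourier inversion (`eq_zero_of_forall_sum_mul_char_eq_zero`); at `x = g₀` this gives
some `j` with `g_j = c g₀`, i.e. `T j = c • T 0`.

Together with `CyclicTwoPowerNondegenerate.lean` (every type of a cyclic `2`-power group is
non-degenerate) this proves on the kernel that `C₈`, `C₁₆`, … carry NO single-class `SumTwo` quadruple
without a conjugate pair — the structural reason behind the census zeros of typer's `QuadRows8.lean`
(`C₈`) and `proofs/p1-g6/singleclass16.out` (`C₁₆`).
-/

set_option autoImplicit false

open Finset
open scoped Pointwise

namespace HodgeRepro

/-! ### Fourier inversion on a finite abelian group -/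

/-- A function on a finite abelian group all of whose character sums vanish is zero
(orthogonality: `∑_ψ ψ(x − y) = |α| · [x = y]`). -/
theorem eq_zero_of_forall_sum_mul_char_eq_zero {α : Type*} [AddCommGroup α] [Fintype α]
    [DecidableEq α] (F : α → ℂ) (h : ∀ ψ : AddChar α ℂ, ∑ x, F x * ψ x = 0) : F = 0 := by
  funext y
  have hcard : (Fintype.card α : ℂ) ≠ 0 := Nat.cast_ne_zero.2 Fintype.card_ne_zero
  have key : (Fintype.card α : ℂ) * F y = 0 := by
    calc (Fintype.card α : ℂ) * F y
        = ∑ x, F x * (if x - y = 0 then (Fintype.card α : ℂ) else 0) := by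
          rw [Finset.sum_eq_single y]
          · rw [sub_self, if_pos rfl, mul_comm]
          · intro x _ hxy
            rw [if_neg (sub_ne_zero.2 hxy), mul_zero]
          · intro hy
            exact absurd (Finset.mem_univ y) hy
      _ = ∑ x, F x * ∑ ψ : AddChar α ℂ, ψ (x - y) := by
          simp only [AddChar.sum_apply_eq_ite]
      _ = ∑ ψ : AddChar α ℂ, ψ (-y) * ∑ x, F x * ψ x := by
          simp only [Finset.mul_sum, sub_eq_add_neg, AddChar.map_add_eq_mul]
          rw [Finset.sum_comm]
          refine Finset.sum_congr rfl fun ψ _ => Finset.sum_congr rfl fun x _ => ?_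
          ring
      _ = 0 := by simp only [h, mul_zero, Finset.sum_const_zero]
  rcases mul_eq_zero.1 key with h0 | h0
  · exact absurd h0 hcard
  · exact h0

variable {G : Type*} [CommGroup G] [Fintype G] [DecidableEq G]

/-! ### (A) Non-degeneracy: every odd character has a non-vanishing sum over `Φ` -/

/-- For a non-degenerate CM type every odd character `χ : G →* ℂˣ` has `∑_{s ∈ Φ} χ s ≠ 0`. -/
theorem charSum_ne_zero_of_isNondegenerate {c : G} (hc : IsComplexConj c) {Φ : Finset G}
    (hΦ : IsCMType c Φ) (hnd : IsNondegenerate Φ) (χ : G →* ℂˣ) (hχ : χ c = -1) :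
    (∑ s ∈ Φ, (χ s : ℂ)) ≠ 0 := by
  intro h0
  -- the two counts
  have hA : Nat.card {χ : G →* ℂˣ // χ c = -1 ∧ (∑ s ∈ Φ, (χ s : ℂ)) ≠ 0} = Φ.card := by
    have := hnd
    unfold IsNondegenerate at this
    rw [Hecke.cmRank_eq_one_add_card_odd hc hΦ, ← Hecke.natCard_homUnits_eq] at this
    omega
  have hB : Nat.card {χ : G →* ℂˣ // χ c = -1} = Φ.card := by
    have h2 := Lit2.two_mul_card_odd_char (G := G) hc.ne_one hc.mul_self
    rw [Nat.card_eq_fintype_card (α := G), ← hΦ.two_mul_card hc] at h2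
    omega
  -- as sets: the first is a strict subset of the second (it misses `χ`)
  have hsub : {χ : G →* ℂˣ | χ c = -1 ∧ (∑ s ∈ Φ, (χ s : ℂ)) ≠ 0} ⊂ {χ : G →* ℂˣ | χ c = -1} := by
    refine ⟨fun ψ hψ => hψ.1, fun hle => ?_⟩
    have := hle hχ
    exact this.2 h0
  have hlt := Set.ncard_lt_ncard hsub (Set.toFinite _)
  rw [← Nat.card_coe_set_eq, ← Nat.card_coe_set_eq] at hlt
  have e1 : Nat.card ↥{χ : G →* ℂˣ | χ c = -1 ∧ (∑ s ∈ Φ, (χ s : ℂ)) ≠ 0} =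
      Nat.card {χ : G →* ℂˣ // χ c = -1 ∧ (∑ s ∈ Φ, (χ s : ℂ)) ≠ 0} := rfl
  have e2 : Nat.card ↥{χ : G →* ℂˣ | χ c = -1} = Nat.card {χ : G →* ℂˣ // χ c = -1} := rfl
  rw [e1, e2, hA, hB] at hlt
  exact lt_irrefl _ hlt

/-! ### (B) `SumTwo` kills the character sums of the twists -/

omit [Fintype G] [DecidableEq G] in
/-- The sum of a character over a twist: `∑_{x ∈ Φ g} χ x = χ g · ∑_{s ∈ Φ} χ s`. -/
theorem sum_char_rmul (Φ : Finset G) (g : G) (χ : G →* ℂˣ) :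
    (∑ x ∈ rmul Φ g, (χ x : ℂ)) = (χ g : ℂ) * ∑ s ∈ Φ, (χ s : ℂ) := by
  unfold rmul
  rw [Finset.sum_map, Finset.mul_sum]
  refine Finset.sum_congr rfl fun s _ => ?_
  simp only [Equiv.coe_toEmbedding, Equiv.coe_mulRight, map_mul, Units.val_mul]
  ring

/-- For a `SumTwo` quadruple of twists `Φ g_i` and an odd character (hence non-trivial, with
`∑_Φ χ ≠ 0` by (A)), `∑_i χ(g_i) = 0`. -/
theorem sum_char_twists_eq_zero {c : G} (hc : IsComplexConj c) {Φ : Finset G}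
    (hΦ : IsCMType c Φ) (hnd : IsNondegenerate Φ) {g : Fin 4 → G}
    (hs : SumTwo fun i => rmul Φ (g i)) (χ : G →* ℂˣ) (hχ : χ c = -1) :
    ∑ i : Fin 4, (χ (g i) : ℂ) = 0 := by
  have hne := charSum_ne_zero_of_isNondegenerate hc hΦ hnd χ hχ
  -- `χ` is non-trivial, so `∑_G χ = 0`
  have hχ1 : χ ≠ 1 := by
    intro h
    rw [h, MonoidHom.one_apply] at hχ
    have := congrArg Units.val hχ
    rw [Units.val_one, Units.val_neg, Units.val_one] at this
    norm_num at this
  have hG : ∑ x : G, (χ x : ℂ) = 0 := by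
    obtain ⟨x₀, hx₀⟩ : ∃ x₀, χ x₀ ≠ 1 := by
      by_contra hall
      push Not at hall
      exact hχ1 (MonoidHom.ext hall)
    have hx₀' : (χ x₀ : ℂ) ≠ 1 := fun h => hx₀ (Units.ext h)
    have hshift : ∑ x : G, (χ x : ℂ) = (χ x₀ : ℂ) * ∑ x : G, (χ x : ℂ) := by
      rw [Finset.mul_sum]
      conv_lhs => rw [← Equiv.sum_comp (Equiv.mulLeft x₀)]
      refine Finset.sum_congr rfl fun x _ => ?_
      simp only [Equiv.coe_mulLeft, map_mul, Units.val_mul]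
    have : ((χ x₀ : ℂ) - 1) * ∑ x : G, (χ x : ℂ) = 0 := by
      rw [sub_mul, one_mul, ← hshift, sub_self]
    rcases mul_eq_zero.1 this with h | h
    · exact absurd (sub_eq_zero.1 h) hx₀'
    · exact h
  -- double counting: `∑_x χ x · #{i : x ∈ Φ g_i} = ∑_i ∑_{x ∈ Φ g_i} χ x`
  have hdc : ∑ x : G, (χ x : ℂ) * ((univ.filter fun i : Fin 4 => x ∈ rmul Φ (g i)).card : ℂ) =
      ∑ i : Fin 4, ∑ x ∈ rmul Φ (g i), (χ x : ℂ) := by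
    simp only [Finset.card_filter, Nat.cast_sum, Nat.cast_ite, Nat.cast_one, Nat.cast_zero,
      Finset.mul_sum, mul_ite, mul_one, mul_zero]
    rw [Finset.sum_comm]
    refine Finset.sum_congr rfl fun i _ => ?_
    rw [Finset.sum_ite_mem, Finset.univ_inter]
  have hst : ∀ x : G, ((univ.filter fun i : Fin 4 => x ∈ rmul Φ (g i)).card : ℂ) = 2 := by
    intro x
    have := hs x
    simp only at this
    rw [this]; norm_num
  simp only [hst, sum_char_rmul] at hdc
  rw [← Finset.sum_mul, ← Finset.sum_mul, hG, zero_mul] at hdc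
  exact (mul_eq_zero.1 hdc.symm).resolve_right hne

/-! ### (C) The multiset of twists is conjugation-stable -/

/-- From `∑_i χ(g_i) = 0` for every odd `χ`: some `g_j` equals `c g₀`. -/
theorem exists_eq_conj_mul_of_forall_sum_eq_zero {c : G} (hc : IsComplexConj c) {g : Fin 4 → G}
    (h : ∀ χ : G →* ℂˣ, χ c = -1 → ∑ i : Fin 4, (χ (g i) : ℂ) = 0) :
    ∃ j : Fin 4, g j = c * g 0 := by
  -- the counting function, on `Additive G`
  let F : Additive G → ℂ := fun x =>
    ((univ.filter fun i : Fin 4 => Additive.ofMul (g i) = x).card : ℂ) -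
      ((univ.filter fun i : Fin 4 => Additive.ofMul (c * g i) = x).card : ℂ)
  have hF : F = 0 := by
    apply eq_zero_of_forall_sum_mul_char_eq_zero
    intro ψ
    -- the character sum of `F` is `(1 - ψ c) ∑_i ψ (g i)`
    have e1 : ∑ x : Additive G,
        ((univ.filter fun i : Fin 4 => Additive.ofMul (g i) = x).card : ℂ) * ψ x =
        ∑ i : Fin 4, ψ (Additive.ofMul (g i)) := by
      simp only [Finset.card_filter, Nat.cast_sum, Finset.sum_mul]
      rw [Finset.sum_comm]
      refine Finset.sum_congr rfl fun i _ => ?_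
      simp only [Nat.cast_ite, Nat.cast_one, Nat.cast_zero, boole_mul]
      rw [Finset.sum_ite_eq, if_pos (Finset.mem_univ _)]
    have e2 : ∑ x : Additive G,
        ((univ.filter fun i : Fin 4 => Additive.ofMul (c * g i) = x).card : ℂ) * ψ x =
        ψ (Additive.ofMul c) * ∑ i : Fin 4, ψ (Additive.ofMul (g i)) := by
      simp only [Finset.card_filter, Nat.cast_sum, Finset.sum_mul]
      rw [Finset.sum_comm, Finset.mul_sum]
      refine Finset.sum_congr rfl fun i _ => ?_
      simp only [Nat.cast_ite, Nat.cast_one, Nat.cast_zero, boole_mul]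
      rw [Finset.sum_ite_eq, if_pos (Finset.mem_univ _), ofMul_mul, AddChar.map_add_eq_mul]
    have hsplit : ∑ x : Additive G, F x * ψ x =
        (1 - ψ (Additive.ofMul c)) * ∑ i : Fin 4, ψ (Additive.ofMul (g i)) := by
      simp only [F, sub_mul, Finset.sum_sub_distrib, e1, e2, one_mul]
    rw [hsplit]
    -- `ψ` is even or odd
    have hψc := Hecke.chiFun_conj_eq_one_or_neg_one hc ψ
    simp only [Hecke.chiFun_apply] at hψc
    rcases hψc with hev | hodd
    · rw [hev, sub_self, zero_mul]
    · -- odd: use the hypothesis through `charEquivHomUnits`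
      have := h (Hecke.charEquivHomUnits ψ) (by
        apply Units.ext
        rw [Hecke.coe_charEquivHomUnits_apply, Hecke.chiFun_apply, hodd, Units.val_neg, Units.val_one])
      have hsum : ∑ i : Fin 4, ((Hecke.charEquivHomUnits ψ) (g i) : ℂ) =
          ∑ i : Fin 4, ψ (Additive.ofMul (g i)) := by
        refine Finset.sum_congr rfl fun i _ => ?_
        rw [Hecke.coe_charEquivHomUnits_apply, Hecke.chiFun_apply]
      rw [hsum] at this
      rw [this, mul_zero]
  -- evaluate at `x = g 0`
  have hF0 := congrFun hF (Additive.ofMul (g 0))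
  simp only [F, Pi.zero_apply, sub_eq_zero] at hF0
  have hA : 0 < (univ.filter fun i : Fin 4 => Additive.ofMul (g i) = Additive.ofMul (g 0)).card :=
    Finset.card_pos.2 ⟨0, by simp⟩
  have hAB : (univ.filter fun i : Fin 4 => Additive.ofMul (g i) = Additive.ofMul (g 0)).card =
      (univ.filter fun i : Fin 4 => Additive.ofMul (c * g i) = Additive.ofMul (g 0)).card := by
    exact_mod_cast hF0
  have hB : 0 < (univ.filter fun i : Fin 4 =>
      Additive.ofMul (c * g i) = Additive.ofMul (g 0)).card := by
    rw [← hAB]; exact hA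
  obtain ⟨j, hj⟩ := Finset.card_pos.1 hB
  rw [Finset.mem_filter] at hj
  refine ⟨j, ?_⟩
  have := hj.2
  rw [Additive.ofMul.apply_eq_iff_eq] at this
  -- `c * g j = g 0`, so `g j = c * g 0`
  rw [← this, ← mul_assoc, hc.mul_self, one_mul]

/-! ### The theorem -/

/-- **Abelian `G`, non-degenerate `Φ`: every `SumTwo` quadruple of twists of `Φ` has a conjugate
pair.** -/
theorem exists_conj_of_sumTwo_of_isNondegenerate {c : G} (hc : IsComplexConj c) {Φ : Finset G}
    (hΦ : IsCMType c Φ) (hnd : IsNondegenerate Φ) {g : Fin 4 → G}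
    (hs : SumTwo fun i => rmul Φ (g i)) :
    ∃ i j : Fin 4, rmul Φ (g j) = c • rmul Φ (g i) := by
  obtain ⟨j, hj⟩ := exists_eq_conj_mul_of_forall_sum_eq_zero hc
    (fun χ hχ => sum_char_twists_eq_zero hc hΦ hnd hs χ hχ)
  have hsr : ∀ S : Finset G, c • S = rmul S c := by
    intro S; ext x
    rw [hc.mem_smul_iff, mem_rmul, hc.inv_eq, mul_comm]
  refine ⟨0, j, ?_⟩
  rw [hj, hsr, rmul_rmul, mul_comm]

/-- **Single-class, `SumTwo`, no conjugate pair ⇒ degenerate** (abelian `G`): the hypothesis that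
typer's `not_isSingleClass_<G>` rows (`QuadFinset12.lean`) and the degree-16 witness
(`SingleClass16Witness.lean`) are about — for a NON-degenerate type the conclusion holds in every
degree. -/
theorem not_isSingleClass_of_isNondegenerate {c : G} (hc : IsComplexConj c)
    (T : Fin 4 → Finset G) (hT : IsCMType c (T 0)) (hnd : IsNondegenerate (T 0)) (hs : SumTwo T)
    (hnc : ∀ i j : Fin 4, T j ≠ c • T i) : ¬ IsSingleClass T := by
  intro hsc
  choose g hg using hsc
  have hs' : SumTwo fun i => rmul (T 0) (g i) := by
    have : (fun i => rmul (T 0) (g i)) = T := by funext i; exact (hg i).symm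
    rw [this]; exact hs
  obtain ⟨i, j, hij⟩ := exists_conj_of_sumTwo_of_isNondegenerate hc hT hnd hs'
  exact hnc i j (by rw [hg j, hg i]; exact hij)

/-- **Cyclic `2`-power groups carry no single-class `SumTwo` quadruple without a conjugate pair**, in
every degree: `CyclicTwoPowerNondegenerate.lean` + the theorem above (the generic form of typer's
`not_isSingleClass_C8` row and of the `C₁₆` census zero). -/
theorem not_isSingleClass_of_cyclic_two_pow [IsCyclic G] {c : G} (hc : IsComplexConj c) {n : ℕ}
    (hcard : Fintype.card G = 2 ^ (n + 1)) (T : Fin 4 → Finset G) (hT : IsCMType c (T 0))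
    (hs : SumTwo T) (hnc : ∀ i j : Fin 4, T j ≠ c • T i) : ¬ IsSingleClass T :=
  not_isSingleClass_of_isNondegenerate hc T hT (isNondegenerate_of_cyclic_two_pow hc hT hcard) hs hnc

end HodgeRepro
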